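import Summits.ResolutionOfSingularities.ResolutionOfSingularities.Theorems.WildQuotientsWildQuotientResolutionS1PlanarFieldDefs

/-! # W1N support `MilnorFloor`: an isolated bad planar node has Milnor number ≥ 2

The first of the five supports of the W1N cascade (`W1NCascade.MilnorFloor`, whose body
`milnorFloor_holds` restates verbatim): if `θ = a ∂x + b ∂y` over a field `κ` has an isolated
singularity at the origin (`κ⟦x,y⟧/(a,b)` finite over `κ`) which is a bad node (`a, b ∈ 𝔪`, linear part
nilpotent), then `dim_κ κ⟦x,y⟧/(a,b) ≥ 2`.  Proof: a nilpotent `2 × 2` matrix over a field has trace and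
determinant `0`; hence for a suitable variable `x_j` the classes of `1` and `x_j` are `κ`-linearly
independent modulo `(a, b)` (compare constant and degree-one coefficients of `u·a + v·b`).
Characteristic-free. [OURS · L1 W4.5c · res-L1-w45c-tri-2] — NOT a statement of the manuscript. -/

set_option linter.dupNamespace false

noncomputable section

open MvPowerSeries

namespace Summit.ResolutionOfSingularities.ResolutionOfSingularities.Theorems.WildQuotientResolution.S1

namespace W1NMilnorFloor

variable {κ : Type} [Field κ]

local notation3 "R" => MvPowerSeries (Fin 2) κ

/-- degree-one coefficient of a product (Leibniz at the origin) -/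
theorem coeff_single_one_mul (i : Fin 2) (u a : R) :
    coeff (Finsupp.single i 1) (u * a) =
      constantCoeff u * coeff (Finsupp.single i 1) a + coeff (Finsupp.single i 1) u * constantCoeff a := by
  rw [coeff_mul, Finsupp.antidiagonal_single, Finset.sum_map]
  simp [Finset.Nat.sum_antidiagonal_succ, MvPowerSeries.coeff_zero_eq_constantCoeff]

/-- a nilpotent `2 × 2` matrix over a field has trace `0` and determinant `0` -/
theorem trace_det_of_isNilpotent (L : Matrix (Fin 2) (Fin 2) κ) (hL : IsNilpotent L) :
    L 0 0 + L 1 1 = 0 ∧ L 0 0 * L 1 1 - L 0 1 * L 1 0 = 0 := by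
  constructor
  · have h := (Matrix.isNilpotent_trace_of_isNilpotent hL).eq_zero
    rwa [Matrix.trace_fin_two] at h
  · obtain ⟨k, hk⟩ := hL
    have h : L.det ^ k = 0 := by rw [← Matrix.det_pow, hk, Matrix.det_zero]
    have h' : L.det = 0 := pow_eq_zero_iff'.1 h |>.1
    rwa [Matrix.det_fin_two] at h'

/-- **Milnor floor**: a planar field with an isolated BAD NODE (vanishing constant part, nilpotent
linear part) has Milnor number `≥ 2` (trace = det = 0 kills the degree-`≤ 1` part of the colength).
[OURS · L1 W4.5c; res-L1-w45c-tri-2, kernel-checked ≠ expert-reviewed] -/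
theorem milnorFloor (θ : PlanarField κ) (hiso : θ.IsIsolated) (hbad : θ.IsBadNode) : 2 ≤ θ.milnor := by
  classical
  obtain ⟨⟨ha0, hb0⟩, hnil⟩ := hbad
  obtain ⟨htr, hdet⟩ := trace_det_of_isNilpotent θ.linearPart hnil
  -- the linear part entries
  have hLa : ∀ j : Fin 2, θ.linearPart 0 j = coeff (Finsupp.single j 1) θ.a := by
    intro j; simp [PlanarField.linearPart]
  have hLb : ∀ j : Fin 2, θ.linearPart 1 j = coeff (Finsupp.single j 1) θ.b := by
    intro j; simp [PlanarField.linearPart]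
  set I : Ideal R := Ideal.span ({θ.a, θ.b} : Set R) with hI
  haveI : Module.Finite κ (R ⧸ I) := hiso
  -- choose the test variable `j`
  have key : ∃ j : Fin 2, ∀ (t : κ) (u v : R), u * θ.a + v * θ.b = C t * X j → t = 0 := by
    by_cases hc : θ.linearPart 0 0 = 0 ∧ θ.linearPart 1 0 = 0
    · refine ⟨0, fun t u v h => ?_⟩
      have e0 := congrArg (coeff (Finsupp.single (0 : Fin 2) 1)) h
      simp only [map_add, coeff_single_one_mul, ha0, hb0, mul_zero, add_zero, coeff_C_mul, coeff_X,
        if_true] at e0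
      rw [← hLa 0, ← hLb 0, hc.1, hc.2] at e0
      simpa using e0.symm
    · refine ⟨1, fun t u v h => ?_⟩
      have e0 := congrArg (coeff (Finsupp.single (0 : Fin 2) 1)) h
      have e1 := congrArg (coeff (Finsupp.single (1 : Fin 2) 1)) h
      have hne : (Finsupp.single (0 : Fin 2) 1 : Fin 2 →₀ ℕ) ≠ Finsupp.single 1 1 := by
        intro h01
        have := Finsupp.single_left_injective (one_ne_zero) |>.eq_iff.1 h01
        exact absurd this (by decide)
      simp only [map_add, coeff_single_one_mul, ha0, hb0, mul_zero, add_zero, coeff_C_mul, coeff_X,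
        if_true, hne, if_false, mul_one] at e0 e1
      rw [← hLa 0, ← hLb 0] at e0
      rw [← hLa 1, ← hLb 1] at e1
      -- e0 : c(u) L00 + c(v) L10 = 0 ;  e1 : c(u) L01 + c(v) L11 = t
      by_cases h00 : θ.linearPart 0 0 = 0
      · have h10 : θ.linearPart 1 0 ≠ 0 := fun h10 => hc ⟨h00, h10⟩
        have h01 : θ.linearPart 0 1 = 0 := by
          have : θ.linearPart 0 1 * θ.linearPart 1 0 = 0 := by
            rw [h00, zero_mul, zero_sub, neg_eq_zero] at hdet; exact hdet
          exact (mul_eq_zero.1 this).resolve_right h10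
        have h11 : θ.linearPart 1 1 = 0 := by rw [h00, zero_add] at htr; exact htr
        rw [h01, h11] at e1
        simpa using e1.symm
      · have := calc
          t * θ.linearPart 0 0
              = (constantCoeff u * θ.linearPart 0 1 + constantCoeff v * θ.linearPart 1 1) *
                  θ.linearPart 0 0 := by rw [e1]
          _ = θ.linearPart 0 1 * (constantCoeff u * θ.linearPart 0 0 +
                constantCoeff v * θ.linearPart 1 0) := by linear_combination constantCoeff v * hdet
          _ = 0 := by rw [e0, mul_zero]
        exact (mul_eq_zero.1 this).resolve_right h00
  obtain ⟨j, hj⟩ := key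
  -- the pair `[1], [X j]` is linearly independent in `R ⧸ I`
  have hli : LinearIndependent κ ![Ideal.Quotient.mk I 1, Ideal.Quotient.mk I (X j)] := by
    rw [LinearIndependent.pair_iff]
    intro s t hst
    have hmem : C s + C t * X j ∈ I := by
      rw [← Ideal.Quotient.eq_zero_iff_mem]
      have h1 : (s • Ideal.Quotient.mk I 1 : R ⧸ I) = Ideal.Quotient.mk I (C s) := by
        rw [← Ideal.Quotient.mk_eq_mk, ← Ideal.Quotient.mk_eq_mk, ← Submodule.Quotient.mk_smul,
          smul_eq_C_mul, mul_one]
      have h2 : (t • Ideal.Quotient.mk I (X j) : R ⧸ I) = Ideal.Quotient.mk I (C t * X j) := by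
        rw [← Ideal.Quotient.mk_eq_mk, ← Ideal.Quotient.mk_eq_mk, ← Submodule.Quotient.mk_smul,
          smul_eq_C_mul]
      rw [map_add, ← h1, ← h2]; exact hst
    obtain ⟨u, v, huv⟩ := Ideal.mem_span_pair.1 hmem
    have hs : s = 0 := by
      have := congrArg constantCoeff huv
      simp [ha0, hb0] at this
      exact this.symm
    subst hs
    have ht : t = 0 := hj t u v (by simpa using huv)
    exact ⟨rfl, ht⟩
  have := hli.fintype_card_le_finrank
  simpa [PlanarField.milnor] using this

/-- The support `W1NCascade.MilnorFloor`, statement body verbatim. [OURS · L1 W4.5c] -/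
theorem milnorFloor_holds :
    ∀ (κ : Type) [Field κ] (θ : PlanarField κ), θ.IsIsolated → θ.IsBadNode → 2 ≤ θ.milnor :=
  fun _ _ θ => milnorFloor θ

end W1NMilnorFloor

end Summit.ResolutionOfSingularities.ResolutionOfSingularities.Theorems.WildQuotientResolution.S1

end
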